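import Summits.HodgeConjecture.HodgeConjecture.Theorems.R90S3QuadraticDenseLift            -- ★ P8b (K2E4-p14): `exists_denseRange_equivariant_lift`
import Summits.HodgeConjecture.HodgeConjecture.Theorems.R90S3LocalTargetTwo                -- ★ B2₂ (K2E3-p36): `exists_localTarget_forall_two`
import Summits.HodgeConjecture.HodgeConjecture.Theorems.R90S3PlantedRootsNear              -- ★ B6 (K2E4-p14): `exists_pow_planted_roots_near`, `norm_lt_one_of_aeval_eq_zero`
import Summits.HodgeConjecture.HodgeConjecture.Theorems.R90S3PlantingTargetListTwo         -- ★ B4₂ (K2E3-p21): `exists_planted_targetList_two`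
import Summits.HodgeConjecture.HodgeConjecture.Theorems.R90S3PadicTargetReading            -- ★ XS (K2E3-p21): `map_toZModPow_target`
import Summits.HodgeConjecture.HodgeConjecture.Theorems.R90S3PlantedTotallyRealField       -- ★ B5+B8 (this seat, ED. 2): `exists_plantedTotallyRealField_with_lift`
import Summits.HodgeConjecture.HodgeConjecture.Theorems.R90S3CMOfTotNegRadicand            -- ★ P7 (this seat): `exists_isCMField_of_forall_re_neg`, §5 transport
import Summits.HodgeConjecture.HodgeConjecture.Theorems.R90S3PlantedTransportAlongEquiv    -- ★ B9 (K2E3-p21): `denseRange_comp_ringEquiv_symm`, `comp_ringEquiv_symm_apply`, `aeval_int_ringEquiv_apply_eq_zero_iff`, …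
import Summits.HodgeConjecture.HodgeConjecture.Theorems.R90S3PlantedDyadicPlacesTwo         -- ★ B7₂ (K2E3-p36): `exists_plantedPlace_two`, `four_dvd_sub_one_of_norm_sub_lt`
import Summits.HodgeConjecture.HodgeConjecture.Theorems.R90S3PlantedDyadicData             -- ★ P8d (K2E3-p21): `exists_planted_dyadic_data`
import Summits.HodgeConjecture.HodgeConjecture.Theorems.R90S3UnramifiedOffPlantedPlace     -- ★ P8c (K2E3-p21): `isUnramifiedAt_of_planted_cm`
import Literature.NumberTheory.Automorphic.Liu2021.LemD1AsPrintedIndexedNonVacuityNonsplitPlace  -- ★ `not_isSquare_delta_sq_of_nonsplit`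
import Literature.NumberTheory.NumberFields.CMFieldTotallyNegativeGenerator               -- ★ `IsCMField.exists_complexConj_ne`, `sq_mem_maximalRealSubfield_of_complexConj_eq_neg`
import Literature.NumberTheory.GaloisRepresentations.PadicAlgebraOfLocalField             -- ★ `LocalField.adicCompletionPadicAlgebra`
import Literature.NumberTheory.NumberFields.CompletionLocalDegree                         -- ★ `finrank_adicCompletionPadicAlgebra_eq`
import HarnessLib

/-!
# R90-TF · S3 · THEOREMS — `R90S3PlantedDenseCMTwo` ((U3-F) assembly, THE DYADIC HALF of the B-target `plantedDenseCM`): at a non-split DYADIC place `v ∣ 2` of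
# `L⁺`, a CM number field `L′` with a dense conjugation-equivariant embedding `L′ → L_w`, `[L′⁺ : ℚ] ≥ 3`, and `L′ ∕ L′⁺` unramified off the place cut out by it

R90-TF section S3 (captain K2E3-p17 (g11) of the (U3-F) socket `stub_R90_S3_auxGlobaliseField`, `Cruxes/H413/Lines/R90_S3_LocalTransportWaveG.lean` :684; B-target
statement frozen by typ2 (g4) 2026-09-05T01:21:48Z, plug `… hv := by exact auxGlobaliseField_of_exists_place_denseCM L v (plantedDenseCM L v hv)` kernel-certified);
crux H413 (`stmt-HodgeConjecture-24833`, lane `--supports … --as helper`), route `HCCMUnconditional`.  This file proves the B-target conclusion under the extra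
hypothesis that `v` is DYADIC (`plantedDenseCM_of_two`); with ★ `plantedDenseCM_of_odd` the two-line case split `plantedDenseCM` follows in
`R90S3PlantedDenseCM.lean`.  At `p = 2` the `p`-adic target and the dyadic target COINCIDE: the extra unit roots `cᵢ ≡ 1 (mod 4)` of ★ `exists_localTarget_forall_two`
are the dyadic data, the planted unit roots `c′ᵢ` stay `≡ 1 (mod 4)` (★ B6 at radius `1/4`), and ★ B7₂ reads `α ≡ 1 (mod 4)` at the planted unit places — no
parity chooser, no `b`-powers, no separate dyadic root reading.  THEOREMS ONLY (no `def`, no `instance`, no notation, no named fact, no `sorry`); ★∕Mathlib imports only; never imports `Cruxes/…/Lines`.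

THE MATHEMATICS — Rogawski's «choose `E∕F` and `w` with `E_w∕F_w ≅ E′∕F′`, `E` CM» [Rogawski1990, §13.8 p. 216], by PLANTING a polynomial [CasselsFrohlichANT1967,
Ch. II §10; NeukirchANT1999, Ch. II (8.2)–(8.5); Gouvea1993PadicNumbers, §5.4, Cor. 6.8.3].  Let `K := L⁺_v ⊃ ℚ_p` (`n := [K:ℚ_p]`), `δ ∈ L` with `δ̄ = −δ ≠ 0`,
`m := δ² ∈ L⁺` — NOT a square in `K` since `v` is non-split (★ Liu App. D).  ★ B2∕§6: a generator `y = m s²` of `K∕ℚ_p` with `p`-small minimal polynomial and an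
exponent `a ≥ 1`; the chooser §7 picks `r ∈ {1,2,3}` with `d := n + r ≥ 3` and `(−1)^d p^a ≡ 1 (mod 4)`; the local target `H = minpoly(y)·∏(X − cᵢ) ∈ ℤ_p[X]`,
`H(0) = p^a`, `cᵢ` distinct units.  ★ B4: a monic irreducible `g ∈ ℤ[X]` of degree `d`, `g(0) = p^a`, `g ≡ H (mod p^N)`, `g ≡ ∏(X − rᵢ) (mod 2^M)` with
`rᵢ ≡ 1 (mod 4)` distinct, all complex roots real and negative; the precisions `N ≥ N₀` (★ B6) and `M ≥ M₀(r⃗)` (★ B12) are fixed BEFORE `g`.  ★ B6: `g` has a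
root `β = y s′² ∈ K` generating `K`, `v(β) < 1`, and `r` distinct unit roots `c′ᵢ ∈ ℤ_p`.  ★ B5: `F := ℚ(α)`, `g(α) = 0`, is totally real of degree `d`, `α`
totally negative, `|N α| = p^a`, with root-lifts `F → K` (`α ↦ β`) and `F → ℚ_p` (`α ↦ c′ᵢ`).  ★ P7: `L′ := F(√α)` is CM with `L′⁺ ≅ F`; everything is
re-based on `L′⁺` (★ B9).  ★ B7: `J₀ : L′⁺ → K` is dense and the places of `L′⁺` are sorted: `α ∈ v′` (the place cut out by `J₀`) and `α ∉ u` for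
EVERY other finite place `u` (units at the `r` planted places over `p`, exhaustion by `Σ e f = d`, ★ P5 off `p`).  ★ B12 + ★ P8d + ★ P8c: `L′ = L′⁺(√α)` is
unramified at every `u ≠ v′` (odd `u`: `α` a unit; dyadic `u`: `α ≡ 1 (mod 4)`).  ★ P8b lifts `J₀` to a dense conjugation-equivariant `J̃ : L′ → L_w`
(`√α ↦ (s s′)·δ`), and the place cut out by `J̃ ∘ (L′⁺ ⊂ L′)` is `v′` (`v_w ∘ ι_w = v_v^{e(w∣v)}`), which gives the B-target's unramifiedness clause.
* **`plantedDenseCM_of_two`** — the dyadic half of the frozen B-target.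

HONEST LABEL: HC_CM is proved only modulo the 7 printed citations (2 remaining named inputs: hLiu418 = stmt-HodgeConjecture-24832, h413 =
stmt-HodgeConjecture-24833) until rung 0 closes; this is the dyadic HALF of the GENUINE residual (U3-F) — the socket stays open until
`plantedDenseCM` (both parities) is ★ and G's plug is BUILT; proves nothing printed; count-neutral.

## References
* [Rogawski1990] J. D. Rogawski, *Automorphic Representations of Unitary Groups in Three Variables* (1990), §13.8 pp. 212–216.
* [CasselsFrohlichANT1967] J. W. S. Cassels, A. Fröhlich (eds.), *Algebraic Number Theory* (1967), Ch. II §10.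
* [NeukirchANT1999] J. Neukirch, *Algebraic Number Theory* (1999), Ch. II (8.2)–(8.5).
* [Gouvea1993PadicNumbers] F. Q. Gouvêa, *p-adic Numbers. An Introduction* (1993/1997), §5.4, Cor. 6.8.3.
-/

set_option autoImplicit false
-- the mandated namespace repeats the single-problem summit's segment (`HodgeConjecture.HodgeConjecture`)
set_option linter.dupNamespace false

noncomputable section

open IsDedekindDomain NumberField Topology Polynomial IntermediateField
open Literature.NumberTheory.Automorphic Literature.NumberTheory.Automorphic.UnitaryGroup
open Literature.NumberTheory.GaloisRepresentations Literature.NumberTheory.NumberFields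

namespace Summit.HodgeConjecture.HodgeConjecture.R90.S3

/-! ## The dyadic half of the B-target -/

variable (L : Type) [Field L] [NumberField L] [IsCMField L] (v : HeightOneSpectrum (𝓞 ↥(maximalRealSubfield L)))

/-- **THE PLANTED DENSE CM DATUM at a non-split DYADIC place** (the dyadic half of the frozen (U3-F) B-target `plantedDenseCM`): a place
`w ∣ v` fixed by complex conjugation, a CM number field `L′`, a ring homomorphism `J : L′ →+* L_w` with dense image intertwining the complex conjugations,
`3 ≤ [L′⁺ : ℚ]`, and «`L′ ∕ L′⁺` is unramified at every finite place `w′` of `L′⁺` other than the one cut out by `J`».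
[cite: Rogawski1990, §13.8 p. 216] [cite: CasselsFrohlichANT1967, Ch. II §10] [cite: NeukirchANT1999, Ch. II (8.2)-(8.5)] -/
theorem plantedDenseCM_of_two (hv : ∀ w : UnitaryGroup.PlacesOver L v, IsCMField.complexConj L • w.1 = w.1)
    (hvp : ((2 : ℕ) : 𝓞 ↥(maximalRealSubfield L)) ∈ v.asIdeal) :
    ∃ (w : PlacesOver L v) (hw : IsCMField.complexConj L • w.1 = w.1)
      (L' : Type) (_ : Field L') (_ : NumberField L') (_ : IsCMField L') (J : L' →+* w.1.adicCompletion L),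
        DenseRange J ∧
        (∀ x : L', J (IsCMField.complexConj L' x) = galAdicCompletionMap (L := L) (IsCMField.complexConj L) hw (J x)) ∧
        3 ≤ Module.finrank ℚ ↥(maximalRealSubfield L') ∧
        (∀ w' : HeightOneSpectrum (𝓞 ↥(maximalRealSubfield L')),
          (¬ ∀ x : 𝓞 ↥(maximalRealSubfield L'), x ∈ w'.asIdeal ↔ Valued.v (J (algebraMap ↥(maximalRealSubfield L') L' x)) < 1) →
          ∀ W : PlacesOver L' w', Algebra.IsUnramifiedAt (𝓞 ↥(maximalRealSubfield L')) W.1.asIdeal) := by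
  classical
  -- STEP 0: a place `w₀ ∣ v` (fixed by conjugation: `v` is non-split), `δ` with `δ̄ = −δ ≠ 0`, `m = δ² ∈ L⁺` not a square in `K = L⁺_v`
  obtain ⟨w₀⟩ := (inferInstance : Nonempty (PlacesOver L v))
  have hw₀ : IsCMField.complexConj L • w₀.1 = w₀.1 := hv w₀
  obtain ⟨x, hx⟩ := IsCMField.exists_complexConj_ne L
  set δ : L := x - IsCMField.complexConj L x with hδdef
  have hcδ : IsCMField.complexConj L δ = -δ := by
    rw [hδdef, map_sub, IsCMField.complexConj_apply_apply, neg_sub]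
  have hδ : δ ≠ 0 := by
    rw [hδdef, sub_ne_zero]
    exact hx.symm
  set m : ↥(maximalRealSubfield L) := ⟨δ ^ 2, sq_mem_maximalRealSubfield_of_complexConj_eq_neg hcδ⟩ with hmdef
  have hm : algebraMap ↥(maximalRealSubfield L) L m = δ ^ 2 := rfl
  have hns : ¬ IsSquare ((m : ↥(maximalRealSubfield L)) : v.adicCompletion ↥(maximalRealSubfield L)) :=
    Liu2021.LemD1IndexedNonVacuityNonsplitPlace.not_isSquare_delta_sq_of_nonsplit L v (IsCMField.complexConj L) hcδ hδ w₀ hw₀ (d := m) (by rw [← sq]; rfl)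
  have hm0' : m ≠ 0 := by
    intro h0
    have : δ ^ 2 = 0 := by rw [← hm, h0, map_zero]
    exact hδ (pow_eq_zero_iff two_ne_zero |>.1 this)
  have hm0 : ((m : ↥(maximalRealSubfield L)) : v.adicCompletion ↥(maximalRealSubfield L)) ≠ 0 := by
    have h := (map_ne_zero (algebraMap ↥(maximalRealSubfield L) (v.adicCompletion ↥(maximalRealSubfield L)))).2 hm0'
    exact h
  -- STEP 1: THE `ℚ_2`-structure on `K := L⁺_v`, finite-dimensional, an embedding `ι : K → Q̄_2`
  letI : Algebra ℚ_[2] (v.adicCompletion ↥(maximalRealSubfield L)) := LocalField.adicCompletionPadicAlgebra v 2 hvp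
  have hc : Continuous (algebraMap ℚ_[2] (v.adicCompletion ↥(maximalRealSubfield L))) :=
    LocalField.continuous_algebraMap_adicCompletionPadicAlgebra v 2 hvp
  have hfr : Module.finrank ℚ_[2] (v.adicCompletion ↥(maximalRealSubfield L)) = v.asIdeal.ramificationIdx ℤ * v.asIdeal.inertiaDeg ℤ :=
    finrank_adicCompletionPadicAlgebra_eq 2 v hvp
  haveI : v.asIdeal.IsPrime := v.isPrime
  have hnpos : 0 < Module.finrank ℚ_[2] (v.adicCompletion ↥(maximalRealSubfield L)) := by
    rw [hfr]
    exact Nat.mul_pos (Ideal.ramificationIdx_pos _ _) (Ideal.inertiaDeg_pos _ _)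
  haveI : FiniteDimensional ℚ_[2] (v.adicCompletion ↥(maximalRealSubfield L)) := Module.finite_of_finrank_pos hnpos
  haveI : Algebra.IsAlgebraic ℚ_[2] (v.adicCompletion ↥(maximalRealSubfield L)) := Algebra.IsAlgebraic.of_finite _ _
  haveI : CharZero (v.adicCompletion ↥(maximalRealSubfield L)) := LocalField.charZero_adicCompletion v
  let ι : v.adicCompletion ↥(maximalRealSubfield L) →ₐ[ℚ_[2]] PadicAlgCl 2 := IsAlgClosed.lift
  set n : ℕ := Module.finrank ℚ_[2] (v.adicCompletion ↥(maximalRealSubfield L)) with hndef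
  -- STEP 2: the dyadic local target (★ B2₂): generator `y = m s²`, exponent `a`, `r` extra unit roots `cᵢ ≡ 1 (mod 4)`, `H(0) = 2^a`
  obtain ⟨y, s, a, r, H, c, hy0, hys, hy, ha1, hlow, hr1, hr3, hd3le, hHm, hHdeg, hH0, -, hHsep, hHy, hcu, hci, hc4, hcZ⟩ :=
    exists_localTarget_forall_two v hc ι hm0
  have hyint : IsIntegral ℚ_[2] y := IsIntegral.of_finite ℚ_[2] y
  have hy1 : ‖ι y‖ < 1 :=
    norm_lt_one_of_aeval_eq_zero 2 (minpoly.monic hyint) (ne_of_gt (minpoly.natDegree_pos hyint)) hlow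
      (by rw [aeval_algHom_apply, minpoly.aeval, map_zero])
  set d : ℕ := n + r with hddef
  have hd2 : 2 ≤ d := by omega
  -- STEP 3: the precision `N₀` of ★ B6 at radius `1/4` (roots of the planted polynomial in `K` and in `1 + 4ℤ_2`)
  obtain ⟨N₀, hN₀⟩ := exists_pow_planted_roots_near 2 v hc ι hy0 hy hy1 H hHm hHsep hHy c hcu hci hcZ (ρ := 1 / 4) (by norm_num)
  -- STEP 4: plant `g` at the precision `N := max N₀ 1`, `2`-adic target `T₂ := H mod 2^N` (★ B4₂ with the auxiliary primes `ℓ₁ := 3`, `ℓ₂ := 5`)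
  haveI : Fact (Nat.Prime 5) := ⟨by norm_num⟩
  set c₀ : ℤ := (2 : ℤ) ^ a with hc₀def
  have hc₀ : 0 < c₀ := pow_pos (by norm_num) a
  have hc₀5 : ¬ ((5 : ℕ) : ℤ) ∣ c₀ := by
    intro h
    have h5 : Prime ((5 : ℕ) : ℤ) := Nat.prime_iff_prime_int.mp (by norm_num)
    have h2 : ((5 : ℕ) : ℤ) ∣ 2 := h5.dvd_of_dvd_pow h
    norm_num at h2
  set N : ℕ := max N₀ 1 with hNdef
  have hN0 : N ≠ 0 := by omega
  have hHd : H.natDegree = d := hHdeg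
  obtain ⟨hTm, hTd, hT0⟩ := map_toZModPow_target hN0 hHm hHd hH0
  obtain ⟨g, hgm, hgd, hg0, hgN, hgirr, -, -, hgC⟩ := exists_planted_targetList_two hd2 3 5 (by norm_num) (by norm_num) (by norm_num) N c₀ hc₀ hc₀5
    (fun _ => by decide) (H.map (PadicInt.toZModPow N)) hTm hTd (by rw [hT0, hc₀def]; push_cast; rfl)
  -- STEP 5: ★ B6 at `N`: the root `β = y s′²` generating `K` with `v(β) < 1`, and the unit roots `c′ᵢ ≡ 1 (mod 4)`
  obtain ⟨β, s', c', hβg, hβtop, hβys, hβ1, -, hc'inj, hc'⟩ := hN₀ N (le_max_left _ _) g hgm (by rw [hgd, hHd]) hgN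
  have hc'4 : ∀ i, (4 : ℤ_[2]) ∣ c' i - 1 := fun i => four_dvd_sub_one_of_norm_sub_lt (hc4 i) (hc' i).2.2
  -- STEP 6: ★ B5: the totally real `F = ℚ(α)` with its root-lifts; ★ P7: the CM field `L′ = F(√α)`; re-base on `L′⁺` (★ B9)
  obtain ⟨F, _, _, _, α, hαg, -, hFd, hαint, hαneg, -, habs, hlift, -⟩ := exists_plantedTotallyRealField_with_lift g hgm hgirr hgC
  have hαgZ : aeval α g = 0 := by
    rw [← aeval_map_algebraMap ℚ α g, algebraMap_int_eq]; exact hαg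
  obtain ⟨L', _, _, _, hquad, hCM, ⟨θ, hθ⟩, hfin'⟩ := exists_isCMField_of_forall_re_neg F α hαneg
  haveI := hquad
  haveI := hCM
  set e : F ≃+* ↥(maximalRealSubfield L') := CMExtension.equivMaximalRealSubfield F L' with hedef
  have hθ' : θ ^ 2 = algebraMap ↥(maximalRealSubfield L') L' (e α) := sq_eq_algebraMap_equivMaximalRealSubfield F L' hθ
  have hα₂int : IsIntegral ℤ (e α) := (isIntegral_int_ringEquiv_apply_iff e α).2 hαint
  set α₂ : 𝓞 ↥(maximalRealSubfield L') := ⟨e α, hα₂int⟩ with hα₂def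
  have hα₂ : ((α₂ : 𝓞 ↥(maximalRealSubfield L')) : ↥(maximalRealSubfield L')) = e α := rfl
  have hα₂neg : ∀ σ : ↥(maximalRealSubfield L') →+* ℂ, (σ (e α)).re < 0 := (forall_re_neg_ringEquiv_apply_iff e α).2 hαneg
  have hθF' : θ ∉ (algebraMap ↥(maximalRealSubfield L') L').range := not_mem_range_algebraMap_of_sq_eq_of_forall_re_neg hα₂neg hθ'
  have hθF : θ ∉ Set.range (algebraMap ↥(maximalRealSubfield L') L') := by
    rintro ⟨z, hz⟩
    exact hθF' ⟨z, hz⟩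
  have hcF : ∀ t : ↥(maximalRealSubfield L'), IsCMField.complexConj L' (algebraMap ↥(maximalRealSubfield L') L' t) =
      algebraMap ↥(maximalRealSubfield L') L' t := fun t => (IsCMField.complexConj L').commutes t
  have hdF : Module.finrank ℚ ↥(maximalRealSubfield L') = Module.finrank ℚ_[2] (v.adicCompletion ↥(maximalRealSubfield L)) + r := by
    rw [hfin', hFd, hgd]
  have hNF : |Algebra.norm ℚ ((α₂ : 𝓞 ↥(maximalRealSubfield L')) : ↥(maximalRealSubfield L'))| = ((2 ^ a : ℕ) : ℚ) := by
    rw [hα₂, norm_rat_ringEquiv_apply e α, habs, hg0, hc₀def]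
    push_cast
    exact abs_of_nonneg (by positivity)
  -- the root-lifts `J₀ : L′⁺ → K` (`e α ↦ β`) and `J i : L′⁺ → ℚ_2` (`e α ↦ c′ᵢ`)
  have hβgQ : aeval β (g.map (Int.castRingHom ℚ)) = 0 := by
    rw [← algebraMap_int_eq, aeval_map_algebraMap]; exact hβg
  obtain ⟨J₀F, hJ₀F⟩ := hlift (v.adicCompletion ↥(maximalRealSubfield L)) β hβgQ
  set J₀ : ↥(maximalRealSubfield L') →+* v.adicCompletion ↥(maximalRealSubfield L) := J₀F.comp e.symm.toRingHom with hJ₀def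
  have hJ₀α : J₀ ((α₂ : 𝓞 ↥(maximalRealSubfield L')) : ↥(maximalRealSubfield L')) = β := by
    rw [hα₂, hJ₀def, comp_ringEquiv_symm_apply, hJ₀F]
  have hJF : ∀ i : Fin r, ∃ Ji : F →+* ℚ_[2], Ji α = ((c' i : ℤ_[2]) : ℚ_[2]) := fun i =>
    hlift ℚ_[2] _ (by rw [← algebraMap_int_eq, aeval_map_algebraMap]; exact (hc' i).2.1)
  choose JF hJFα using hJF
  set J : Fin r → (↥(maximalRealSubfield L') →+* ℚ_[2]) := fun i => (JF i).comp e.symm.toRingHom with hJdef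
  have hJα : ∀ i, J i ((α₂ : 𝓞 ↥(maximalRealSubfield L')) : ↥(maximalRealSubfield L')) = ((c' i : ℤ_[2]) : ℚ_[2]) := by
    intro i
    rw [hα₂, hJdef]
    dsimp only
    rw [comp_ringEquiv_symm_apply, hJFα]
  -- STEP 7: ★ B7₂: `J₀` is dense; the planted place `v′ ∋ α`, `α ∉ u` for every other finite place `u` of `L′⁺`, and `α ≡ 1 (mod 4)` at the dyadic `u ≠ v′`
  obtain ⟨hJ₀d, v', hv'pin, -, -, hαu, hα4⟩ :=
    exists_plantedPlace_two v hvp hc α₂ hdF hNF J₀ hJ₀α hβtop hβ1 c' (fun i => (hc' i).1) hc'inj J hJα hc'4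
  -- STEP 8: «`L′ ∕ L′⁺` unramified off `v′`» (★ P8d dyadic data, ★ P8c)
  have hαu_odd : ∀ u : HeightOneSpectrum (𝓞 ↥(maximalRealSubfield L')), u ≠ v' → (2 : 𝓞 ↥(maximalRealSubfield L')) ∉ u.asIdeal → α₂ ∉ u.asIdeal :=
    fun u hu _ => hαu u hu
  have hαu2 : ∀ u : HeightOneSpectrum (𝓞 ↥(maximalRealSubfield L')), u ≠ v' → (2 : 𝓞 ↥(maximalRealSubfield L')) ∈ u.asIdeal → α₂ ∉ u.asIdeal :=
    fun u hu _ => hαu u hu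
  obtain ⟨xx, m₁, ξ, hξ, hm₁, hxx, hm₁u⟩ := exists_planted_dyadic_data v' α₂ hαu2 hα4
  have hur0 := isUnramifiedAt_of_planted_cm L' v' α₂ hθ' hθF' hαu_odd xx m₁ ξ hξ hm₁ hxx hm₁u
  -- STEP 10: ★ P8b: the dense equivariant lift `J̃ : L′ → L_w` (`√α ↦ (s s′)·δ`)
  obtain ⟨w, hw, Jt, hJtd, hJtσ, hJtF, -⟩ := exists_denseRange_equivariant_lift L v hcδ hδ hm hns ↥(maximalRealSubfield L') L'
    hθ' hθF hcF J₀ hJ₀d (s * s') (by rw [← hα₂, hJ₀α, hβys, hys]; ring)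
  -- STEP 11: assemble
  have h3 : 3 ≤ Module.finrank ℚ ↥(maximalRealSubfield L') := by rw [hdF]; omega
  refine ⟨w, hw, L', inferInstance, inferInstance, inferInstance, Jt, hJtd, hJtσ, h3, ?_⟩
  intro w' hw' W
  refine hur0 w' ?_ W
  rintro rfl
  apply hw'
  intro z
  haveI := PlacesOver.liesOver (E := L) w
  have he0 : v.asIdeal.ramificationIdx' w.1.asIdeal ≠ 0 := Ideal.IsDedekindDomain.ramificationIdx'_ne_zero_of_liesOver w.1.asIdeal v.ne_bot
  rw [hv'pin z, hJtF, valued_toPlace]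
  exact (pow_lt_one_iff he0).symm

end Summit.HodgeConjecture.HodgeConjecture.R90.S3

end
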